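import Summits.NavierStokesRegularity.NavierStokesRegularity.Theorems.SelfMixingDichotomySequentialTypeIExclusionSupFormOfNoLocalTypeIRelRate
import Literature.Analysis.FluidPDE.SereginSverakOffAxisTools
import HarnessLib

/-!
# Route SelfMixingDichotomy · crux `SequentialTypeIExclusion` (S1): the shared conjecture excludes
# point blow-up at a Type-I rate relative to the point (no centred hypothesis needed)

Helper file of the crux item stmt-NavierStokesRegularity-1424 (lands `--supports` that item; line
`registered`, lead c5); third file of the group `…SupFormOfNoLocalTypeI{,RelRate}.lean`.

`supForm_of_not_localTypeISingularityExists_of_relTypeI` (previous file) derives boundedness near a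
final-time point `(T, x₀)` from the SHARED conjecture `¬ LocalTypeISingularityExists` under TWO
hypotheses: the centred cubic Type-I bound of `S1_sup` and a pointwise Type-I rate relative to the
point, `max(‖x − x₀‖, √(T − t)) ‖u(t, x)‖ ≤ K` on some `Q_{r₂}(T, x₀)`. Here the first hypothesis is
shown to follow from the second:

* `cknC_le_of_relTypeI` — the relative rate alone gives the centred cubic bound
  `C(r; T, x₀) ≤ 16 K³ |B₁|` for `0 < r ≤ r₂`: decompose `Q_r(T, x₀)` into the dyadic parabolic
  annuli `Q_{r/2ʲ} \ Q_{r/2ʲ⁺¹}` (they exhaust the cylinder since `t < T`), on which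
  `‖u‖ ≤ 2ʲ⁺¹K/r` and whose volumes are `(r/2ʲ)⁵|B₁|`; the series is geometric. (So points with a
  relative Type-I rate fall under `S1_sup`'s hypothesis.)
* `bdd_of_not_localTypeISingularityExists_of_relTypeI` — HENCE, if no local Type I singular point
  exists (Albritton–Barker 2019, Thm. 1.1, first bullet, negated; in tree a consequence of the
  Liouville conjecture (L) of Koch–Nadirashvili–Seregin–Šverák 2009), a classical Leray–Hopf
  solution (`ν = 1`, rapidly decaying datum) is bounded near every final-time point about which it
  obeys a Type-I rate relative to the point. In words: the shared conjecture excludes blow-up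
  dominated near the point by a Leray-type envelope `K/(‖x − x₀‖ + √(T − t))` — the local,
  one-point form of "(L) excludes Type I blow-up" (KNSS 2009), obtained here through the
  Albritton–Barker zoom rather than by rescaling around near-maximum points.

## References

* D. Albritton, T. Barker, J. Math. Fluid Mech. 21 (2019) = arXiv:1811.00502, Thm. 1.1, Lemma 2.6.
  [AlbrittonBarker2019]
* G. Koch, N. Nadirashvili, G. Seregin, V. Šverák, Acta Math. 203 (2009) 83–105, §1 (conjecture (L)
  and Type I). [KNSS2009]
* J. Leray, Acta Math. 63 (1934), §20 (the rate `(T − t)^{-1/2}`). [Leray1934]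
-/

noncomputable section

set_option linter.dupNamespace false -- nested layout Summit.<S>.<Sub>, Sub = S (D-0017)

open Set Filter Topology MeasureTheory

namespace Summit.NavierStokesRegularity.NavierStokesRegularity.Theorems.SequentialTypeIExclusion.Registered

open Literature.Analysis.FluidPDE Function TopologicalSpace Metric
open scoped ENNReal NNReal

/-- **A Type-I rate relative to the point bounds the centred cubic quantity.** If
`max(‖x − x₀‖, √(T − t)) ‖u(t, x)‖ ≤ K` on `Q_{r₂}(T, x₀)`, then `C(r; T, x₀) ≤ 16 K³ |B₁|` for every
`0 < r ≤ r₂`: on the dyadic parabolic annulus `Q_{r/2ʲ}(T,x₀) \ Q_{r/2ʲ⁺¹}(T,x₀)` the rate gives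
`‖u‖ ≤ 2ʲ⁺¹ K / r`, its volume is at most `(r/2ʲ)⁵ |B₁|`, the annuli exhaust `Q_r(T, x₀)` (every point
has `t < T`), and `Σⱼ 8K³r²4⁻ʲ ≤ 16 K³ r²`. [folklore] -/
theorem cknC_le_of_relTypeI {T K r₂ : ℝ}
    {u : ℝ → EuclideanSpace ℝ (Fin 3) → EuclideanSpace ℝ (Fin 3)} {x₀ : EuclideanSpace ℝ (Fin 3)}
    (hr₂ : 0 < r₂)
    (hK : ∀ (t : ℝ) (x : EuclideanSpace ℝ (Fin 3)),
      ((t, x) : ℝ × EuclideanSpace ℝ (Fin 3)) ∈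
        parabolicCylinder r₂ ((T, x₀) : ℝ × EuclideanSpace ℝ (Fin 3)) →
      max ‖x - x₀‖ (Real.sqrt (T - t)) * ‖u t x‖ ≤ K)
    {r : ℝ} (hr : 0 < r) (hrr₂ : r ≤ r₂) :
    cknC r ((T, x₀) : ℝ × EuclideanSpace ℝ (Fin 3)) u ≤
      ENNReal.ofReal (16 * K ^ 3) * volume (ball (0 : EuclideanSpace ℝ (Fin 3)) 1) := by
  -- `K ≥ 0`: the cylinder `Q_{r₂}(T, x₀)` is nonempty
  have hK0 : 0 ≤ K := by
    have hw : ((T - r₂ ^ 2 / 2, x₀) : ℝ × EuclideanSpace ℝ (Fin 3)) ∈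
        parabolicCylinder r₂ ((T, x₀) : ℝ × EuclideanSpace ℝ (Fin 3)) := by
      rw [mem_parabolicCylinder]
      refine ⟨⟨by nlinarith, by nlinarith⟩, by simpa using hr₂⟩
    exact le_trans (by positivity) (hK _ _ hw)
  set z₀ : ℝ × EuclideanSpace ℝ (Fin 3) := (T, x₀) with hz₀
  set B : ℝ≥0∞ := volume (ball (0 : EuclideanSpace ℝ (Fin 3)) 1) with hB
  -- dyadic radii and annuli
  set ρ : ℕ → ℝ := fun j => r * (1 / 2) ^ j with hρ
  have hρpos : ∀ j, 0 < ρ j := fun j => by positivity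
  have hρ0 : ρ 0 = r := by simp [hρ]
  have hρsucc : ∀ j, ρ (j + 1) = ρ j / 2 := fun j => by
    simp only [hρ, pow_succ]; ring
  have hρle : ∀ j, ρ j ≤ r := fun j => by
    have : (1 / 2 : ℝ) ^ j ≤ 1 := pow_le_one₀ (by norm_num) (by norm_num)
    calc ρ j = r * (1 / 2) ^ j := rfl
      _ ≤ r * 1 := by gcongr
      _ = r := mul_one r
  set A : ℕ → Set (ℝ × EuclideanSpace ℝ (Fin 3)) :=
    fun j => parabolicCylinder (ρ j) z₀ \ parabolicCylinder (ρ (j + 1)) z₀ with hA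
  have hAmeas : ∀ j, MeasurableSet (A j) := fun j =>
    (isOpen_parabolicCylinder _ _).measurableSet.diff (isOpen_parabolicCylinder _ _).measurableSet
  -- the annuli exhaust `Q_r(T, x₀)`
  have hcover : parabolicCylinder r z₀ ⊆ ⋃ j, A j := by
    intro w hw
    have hw' := hw
    rw [mem_parabolicCylinder] at hw'
    have hwT : 0 < T - w.1 := by have := hw'.1.2; simp only [hz₀] at this; linarith
    have hex : ∃ j, w ∉ parabolicCylinder (ρ j) z₀ := by
      obtain ⟨n, hn⟩ := exists_pow_lt_of_lt_one (show 0 < (T - w.1) / r ^ 2 by positivity)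
        (show (1 / 2 : ℝ) < 1 by norm_num)
      refine ⟨n, fun h => ?_⟩
      rw [mem_parabolicCylinder] at h
      have h1 := h.1.1
      simp only [hz₀] at h1
      have hle1 : ((1 / 2 : ℝ) ^ n) ^ 2 ≤ (1 / 2) ^ n := by
        rw [← pow_mul]
        exact pow_le_pow_of_le_one (by norm_num) (by norm_num) (by omega)
      have h2 : ρ n ^ 2 ≤ r ^ 2 * (1 / 2) ^ n := by
        calc ρ n ^ 2 = r ^ 2 * ((1 / 2 : ℝ) ^ n) ^ 2 := by simp only [hρ]; ring
          _ ≤ r ^ 2 * (1 / 2) ^ n := by gcongr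
      have h3 : r ^ 2 * (1 / 2 : ℝ) ^ n < T - w.1 := by
        rwa [lt_div_iff₀ (by positivity : (0 : ℝ) < r ^ 2), mul_comm] at hn
      linarith
    classical
    have hj₀ := Nat.find_spec hex
    have hj₀pos : Nat.find hex ≠ 0 := by
      intro h0
      rw [h0, hρ0] at hj₀
      exact hj₀ hw
    obtain ⟨k, hk⟩ := Nat.exists_eq_succ_of_ne_zero hj₀pos
    have hkin : w ∈ parabolicCylinder (ρ k) z₀ := by
      by_contra hnot
      exact Nat.find_min hex (show k < Nat.find hex by omega) hnot
    refine mem_iUnion.2 ⟨k, hkin, ?_⟩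
    rw [hk] at hj₀
    exact hj₀
  -- the rate on the `j`-th annulus: `‖u‖³ ≤ (K / ρ_{j+1})³`
  have hbd : ∀ j, ∀ w ∈ A j, ‖u w.1 w.2‖ₑ ^ (3 : ℕ) ≤ ENNReal.ofReal ((K / ρ (j + 1)) ^ 3) := by
    rintro j w ⟨hw1, hw2⟩
    have hwr₂ : w ∈ parabolicCylinder r₂ z₀ :=
      parabolicCylinder_mono (hρpos j).le ((hρle j).trans hrr₂) z₀ hw1
    have hKw := hK w.1 w.2 hwr₂
    rw [mem_parabolicCylinder] at hw1
    have hm : ρ (j + 1) ≤ max ‖w.2 - x₀‖ (Real.sqrt (T - w.1)) := by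
      by_contra hlt
      rw [not_le] at hlt
      apply hw2
      rw [mem_parabolicCylinder]
      have h1 : ‖w.2 - x₀‖ < ρ (j + 1) := lt_of_le_of_lt (le_max_left _ _) hlt
      have h2 : Real.sqrt (T - w.1) < ρ (j + 1) := lt_of_le_of_lt (le_max_right _ _) hlt
      have h3 : T - w.1 < ρ (j + 1) ^ 2 := (Real.sqrt_lt' (hρpos _)).1 h2
      refine ⟨⟨?_, hw1.1.2⟩, ?_⟩
      · simp only [hz₀]; linarith
      · rw [dist_eq_norm]; simpa [hz₀] using h1
    have hm0 : 0 < max ‖w.2 - x₀‖ (Real.sqrt (T - w.1)) := (hρpos _).trans_le hm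
    have hu : ‖u w.1 w.2‖ ≤ K / ρ (j + 1) :=
      calc ‖u w.1 w.2‖ ≤ K / max ‖w.2 - x₀‖ (Real.sqrt (T - w.1)) := by
            rw [le_div_iff₀ hm0, mul_comm]; exact hKw
        _ ≤ K / ρ (j + 1) := div_le_div_of_nonneg_left hK0 (hρpos _) hm
    have h1 : ‖u w.1 w.2‖ₑ ≤ ENNReal.ofReal (K / ρ (j + 1)) := by
      rw [← ofReal_norm]; exact ENNReal.ofReal_le_ofReal hu
    calc ‖u w.1 w.2‖ₑ ^ (3 : ℕ) ≤ ENNReal.ofReal (K / ρ (j + 1)) ^ (3 : ℕ) := by gcongr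
      _ = ENNReal.ofReal ((K / ρ (j + 1)) ^ 3) := (ENNReal.ofReal_pow (by positivity) 3).symm
  -- the integral over the `j`-th annulus
  have hAj : ∀ j, ∫⁻ w in A j, ‖u w.1 w.2‖ₑ ^ (3 : ℕ) ≤
      ENNReal.ofReal (8 * K ^ 3 * r ^ 2) * B * (2⁻¹ : ℝ≥0∞) ^ j := by
    intro j
    have hreal : (K / ρ (j + 1)) ^ 3 * ρ j ^ 5 ≤ 8 * K ^ 3 * r ^ 2 * (1 / 2) ^ j := by
      rw [hρsucc]
      have hρj : ρ j ≠ 0 := (hρpos j).ne'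
      have e : (K / (ρ j / 2)) ^ 3 * ρ j ^ 5 = 8 * K ^ 3 * ρ j ^ 2 := by
        field_simp
        ring
      rw [e]
      have h14 : ρ j ^ 2 = r ^ 2 * ((1 / 2 : ℝ) ^ j) ^ 2 := by simp only [hρ]; ring
      have hle1 : ((1 / 2 : ℝ) ^ j) ^ 2 ≤ (1 / 2) ^ j := by
        rw [← pow_mul]
        exact pow_le_pow_of_le_one (by norm_num) (by norm_num) (by omega)
      calc 8 * K ^ 3 * ρ j ^ 2 = 8 * K ^ 3 * r ^ 2 * ((1 / 2 : ℝ) ^ j) ^ 2 := by rw [h14]; ring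
        _ ≤ 8 * K ^ 3 * r ^ 2 * (1 / 2) ^ j := by gcongr
    have hhalf : ENNReal.ofReal ((1 / 2 : ℝ) ^ j) = (2⁻¹ : ℝ≥0∞) ^ j := by
      rw [ENNReal.ofReal_pow (by norm_num), one_div, ENNReal.ofReal_inv_of_pos two_pos,
        ENNReal.ofReal_ofNat]
    calc ∫⁻ w in A j, ‖u w.1 w.2‖ₑ ^ (3 : ℕ)
        ≤ ∫⁻ _ in A j, ENNReal.ofReal ((K / ρ (j + 1)) ^ 3) := by
          refine lintegral_mono_ae ?_
          rw [ae_restrict_iff' (hAmeas j)]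
          exact ae_of_all _ (hbd j)
      _ = ENNReal.ofReal ((K / ρ (j + 1)) ^ 3) * volume (A j) := setLIntegral_const _ _
      _ ≤ ENNReal.ofReal ((K / ρ (j + 1)) ^ 3) * volume (parabolicCylinder (ρ j) z₀) := by
          gcongr; exact Set.sdiff_subset
      _ = ENNReal.ofReal ((K / ρ (j + 1)) ^ 3 * ρ j ^ 5) * B := by
          rw [SereginSverak2009.volume_parabolicCylinder_eq z₀ (hρpos j).le, ← mul_assoc,
            ← ENNReal.ofReal_mul (by positivity)]
      _ ≤ ENNReal.ofReal (8 * K ^ 3 * r ^ 2 * (1 / 2) ^ j) * B := by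
          gcongr
      _ = ENNReal.ofReal (8 * K ^ 3 * r ^ 2) * B * (2⁻¹ : ℝ≥0∞) ^ j := by
          rw [ENNReal.ofReal_mul (by positivity), hhalf]; ring
  -- sum over the annuli
  have hr2 : ENNReal.ofReal r ^ 2 ≠ 0 := pow_ne_zero 2 (ENNReal.ofReal_pos.2 hr).ne'
  have hr2' : ENNReal.ofReal r ^ 2 ≠ ⊤ := ENNReal.pow_ne_top ENNReal.ofReal_ne_top
  rw [cknC]
  calc (ENNReal.ofReal r ^ 2)⁻¹ * ∫⁻ w in parabolicCylinder r z₀, ‖u w.1 w.2‖ₑ ^ (3 : ℕ)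
      ≤ (ENNReal.ofReal r ^ 2)⁻¹ * ∑' j, ∫⁻ w in A j, ‖u w.1 w.2‖ₑ ^ (3 : ℕ) := by
        gcongr
        exact (lintegral_mono_set hcover).trans (lintegral_iUnion_le _ _)
    _ ≤ (ENNReal.ofReal r ^ 2)⁻¹ *
          ∑' j : ℕ, ENNReal.ofReal (8 * K ^ 3 * r ^ 2) * B * (2⁻¹ : ℝ≥0∞) ^ j := by
        gcongr with j
        exact hAj j
    _ = (ENNReal.ofReal r ^ 2)⁻¹ * (ENNReal.ofReal (8 * K ^ 3 * r ^ 2) * B * 2) := by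
        rw [ENNReal.tsum_mul_left, ENNReal.tsum_geometric_two]
    _ = ENNReal.ofReal (16 * K ^ 3) * B := by
        have e1 : ENNReal.ofReal (8 * K ^ 3 * r ^ 2) =
            ENNReal.ofReal r ^ 2 * ENNReal.ofReal (8 * K ^ 3) := by
          rw [← ENNReal.ofReal_pow hr.le, ← ENNReal.ofReal_mul (by positivity)]
          congr 1
          ring
        have e2 : ENNReal.ofReal (16 * K ^ 3) = ENNReal.ofReal (8 * K ^ 3) * 2 := by
          rw [show (16 : ℝ) * K ^ 3 = (8 * K ^ 3) * 2 by ring,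
            ENNReal.ofReal_mul (by positivity), ENNReal.ofReal_ofNat]
        rw [e1, e2]
        calc (ENNReal.ofReal r ^ 2)⁻¹ * (ENNReal.ofReal r ^ 2 * ENNReal.ofReal (8 * K ^ 3) * B * 2)
            = ((ENNReal.ofReal r ^ 2)⁻¹ * ENNReal.ofReal r ^ 2) *
                (ENNReal.ofReal (8 * K ^ 3) * 2 * B) := by ring
          _ = ENNReal.ofReal (8 * K ^ 3) * 2 * B := by
                rw [ENNReal.inv_mul_cancel hr2 hr2', one_mul]

/-- **The shared conjecture excludes point blow-up at a Type-I rate relative to the point.** If no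
suitable weak solution of the unforced unit-viscosity Navier–Stokes system has a local Type I
singular point (`¬ LocalTypeISingularityExists`: Albritton–Barker 2019, Thm. 1.1, first bullet,
negated — in tree a consequence of the Liouville conjecture (L) of KNSS 2009), then every classical
Leray–Hopf solution (`ν = 1`) on `ℝ³ × [0, T)` from a rapidly decaying datum is bounded near every
final-time point `(T, x₀)` about which it obeys a pointwise Type-I rate relative to the point,
`max(‖x − x₀‖, √(T − t)) ‖u(t, x)‖ ≤ K` on some `Q_{r₂}(T, x₀)` — no centred hypothesis is needed
(`cknC_le_of_relTypeI` supplies it to `supForm_of_not_localTypeISingularityExists_of_relTypeI`).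
This is the local, one-point form of "(L) excludes Type I blow-up" (KNSS 2009, via
Albritton–Barker's zoom); for the crux S1 it says that the relative-Type-I scenario at a final-time
point lies inside `S1_sup` AND is settled by the shared conjecture.
[cite: AlbrittonBarker2019, Thm. 1.1 and Lemma 2.6; KNSS2009, §1] -/
theorem bdd_of_not_localTypeISingularityExists_of_relTypeI :
    ¬ Literature.Analysis.FluidPDE.LocalTypeISingularityExists →
      ∀ K : ℝ, ∀ T : ℝ, 0 < T →
        ∀ (u : ℝ → EuclideanSpace ℝ (Fin 3) → EuclideanSpace ℝ (Fin 3))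
          (p : ℝ → EuclideanSpace ℝ (Fin 3) → ℝ),
          Literature.Analysis.FluidPDE.IsClassicalNSSolutionOn (Set.Ico 0 T) 1 0 u p →
          Literature.Analysis.FluidPDE.IsLerayHopfOn T 1 0 (u 0) u →
          Literature.Analysis.FluidPDE.HasRapidSpatialDecay (u 0) →
          ∀ x₀ : EuclideanSpace ℝ (Fin 3),
            (∃ r₂ : ℝ, 0 < r₂ ∧ ∀ (t : ℝ) (x : EuclideanSpace ℝ (Fin 3)),
              ((t, x) : ℝ × EuclideanSpace ℝ (Fin 3)) ∈
                Literature.Analysis.FluidPDE.parabolicCylinder r₂ ((T, x₀) : ℝ × EuclideanSpace ℝ (Fin 3)) →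
              max ‖x - x₀‖ (Real.sqrt (T - t)) * ‖u t x‖ ≤ K) →
            ∃ ρ : ℝ, 0 < ρ ∧ ∃ M : ℝ, ∀ t ∈ Set.Ioo (T - ρ ^ 2) T,
              ∀ x ∈ Metric.ball x₀ ρ, ‖u t x‖ ≤ M := by
  intro hno K T hT u p hsol hLH hdec x₀ hrate
  obtain ⟨r₂, hr₂, hK⟩ := hrate
  set B : ℝ≥0∞ := volume (ball (0 : EuclideanSpace ℝ (Fin 3)) 1) with hB
  have hBtop : B ≠ ⊤ := measure_ball_lt_top.ne
  have hK0 : 0 ≤ K := by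
    have hw : ((T - r₂ ^ 2 / 2, x₀) : ℝ × EuclideanSpace ℝ (Fin 3)) ∈
        parabolicCylinder r₂ ((T, x₀) : ℝ × EuclideanSpace ℝ (Fin 3)) := by
      rw [mem_parabolicCylinder]
      refine ⟨⟨by nlinarith, by nlinarith⟩, by simpa using hr₂⟩
    exact le_trans (by positivity) (hK _ _ hw)
  have hcen : ∃ r₁ : ℝ, 0 < r₁ ∧ ∀ r ∈ Set.Ioo 0 r₁,
      cknC r ((T, x₀) : ℝ × EuclideanSpace ℝ (Fin 3)) u ≤
        ENNReal.ofReal (16 * K ^ 3 * B.toReal) := by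
    refine ⟨r₂, hr₂, fun r hr => ?_⟩
    calc cknC r ((T, x₀) : ℝ × EuclideanSpace ℝ (Fin 3)) u
        ≤ ENNReal.ofReal (16 * K ^ 3) * B := cknC_le_of_relTypeI hr₂ hK hr.1 hr.2.le
      _ = ENNReal.ofReal (16 * K ^ 3 * B.toReal) := by
          conv_rhs => rw [ENNReal.ofReal_mul (by positivity : (0 : ℝ) ≤ 16 * K ^ 3),
            ENNReal.ofReal_toReal hBtop]
  exact supForm_of_not_localTypeISingularityExists_of_relTypeI hno _ K T hT u p hsol hLH hdec x₀
    hcen ⟨r₂, hr₂, hK⟩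

end Summit.NavierStokesRegularity.NavierStokesRegularity.Theorems.SequentialTypeIExclusion.Registered

end
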